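import Mathlib
import HarnessLib
import Summits.KontsevichZagierPeriods.KontsevichZagierPeriods.Theses.LinRedNormalForm
import Summits.KontsevichZagierPeriods.KontsevichZagierPeriods.Theses.ScissorsAvatars
import Summits.KontsevichZagierPeriods.KontsevichZagierPeriods.Theses.FurushoPentagon
import Summits.KontsevichZagierPeriods.KontsevichZagierPeriods.Theorems.ResidualBeyondGenusZero.Negative.LoadBearing
import Summits.KontsevichZagierPeriods.KontsevichZagierPeriods.Theorems.LinRedNormalFormResidualBeyondGenusZeroStrength

/-!
# Route LinRedNormalForm, item `ResidualBeyondGenusZero` (stmt-KontsevichZagierPeriods-3917): comparisons with the other routes' declared residuals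

`ResidualBeyondGenusZero` (RES) is route LinRedNormalForm's DECLARED RESIDUAL: every vanishing
formal combination is congruent modulo `KZ.relations` to a `ℤ`-combination of genus-zero
representations (`Negative.gzSet`). Several other routes of the summit file a declared complement
of the same shape with a SMALLER target family. This file records, sorry-free, where RES sits among
them — it is the WEAKEST (most permissive) of the MZV-type residuals — and the exact form RES takes
once the genus-zero normal form `DihedralNormalForm` is available:

* `isGenusZero_mzvRep`, `of_mzvRep_mem_gzSet` — Kontsevich's simplex representation `KZ.mzvRep s`
  of `ζ(s)` has the genus-zero shape (`P = 1`, `bᵢ = [εᵢ = 0]`, `cᵢ = [εᵢ = 1]`, `a = 0`);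
* `wordRepSet_subset_gzSet` — so does every MZV WORD representation `[Δ_w, q·∏ω_ε]` (the target
  generators of `DihedralNormalForm`; `P = C q`), hence `closure wordRepSet ≤ closure gzSet`;
* `residualBeyondGenusZero_of_residualOnto` — MONOTONICITY: a residual onto any family of
  genus-zero classes implies RES;
* `residualBeyondGenusZero_of_offSectorReduction` — route ScissorsAvatars' declared complement
  `OffSectorReduction` (stmt-KontsevichZagierPeriods-4265: reduction to a vanishing single-weight
  `ℤ`-combination of the canonical `mzvRep`s) implies RES; with
  `offSectorReduction_of_kzKernelConjecture` and the Strength file this sandwiches BOTH declared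
  residuals between the kernel conjecture and RES, so granted the LinRedNormalForm sector cruxes
  they are equivalent to each other and to the summit (`offSectorReduction_iff_residualBeyondGenusZero`);
* `residualBeyondGenusZero_of_sectorToKernel` — route FurushoPentagon's kernel item
  `SectorToKernel` (with its two move-level hypotheses) implies RES;
* `residualOntoWords_of_residualBeyondGenusZero`, `residualBeyondGenusZero_iff_residualOntoWords` —
  granted `DihedralNormalForm` alone, RES is EQUIVALENT to the residual onto the MZV word
  representations: after the normal-form crux closes, the declared residual of the route is
  "every vanishing combination is an MZV-word combination modulo moves", with no further glue.

Nothing here changes the standing of the item (summit-strength declared residual, planner hold):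
these are DAG edges between declared residuals, for the planners' tenure split / dedup.

References: M. Kontsevich, D. Zagier, *Periods* (2001), §§1.1–1.2 (Kontsevich's formula,
Conjecture 1); A. Huber, S. Müller-Stach, *Periods and Nori Motives* (2017), Conj. 13.2.1.
-/

noncomputable section

namespace Summit.KontsevichZagierPeriods.ResidualBeyondGenusZero

open MeasureTheory Set
open Literature.NumberTheory.Transcendental
open Summit.KontsevichZagierPeriods.KontsevichZagierPeriods.Theses.LinRedNormalForm
open Summit.KontsevichZagierPeriods.KontsevichZagierPeriods.Theses.ScissorsAvatars (OffSectorReduction)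
open Summit.KontsevichZagierPeriods.KontsevichZagierPeriods.Theses.FurushoPentagon
  (SectorToKernel StuffleInKZ HoffmanRelationInKZ)
open Summit.KontsevichZagierPeriods.DihedralNormalForm.Negative
  (simplex gzIntegrand IsGenusZero wordRepSet crux_iff)

/-! ## Kontsevich's simplex representations and MZV word representations are genus-zero -/

/-- **`mzvRep s` is genus-zero.** Kontsevich's representation `[Δ_w, ∏ᵢ ω_{εᵢ}(tᵢ)]` of `ζ(s)`
(`KZ.mzvRep`, Kontsevich–Zagier 2001, §1.1) has the genus-zero shape of the route: domain the open
ordered simplex, integrand `P/(∏ tᵢ^{bᵢ} ∏ (1-tᵢ)^{cᵢ} ∏_{i<j}(tᵢ-tⱼ)^{aᵢⱼ})` with `P = 1`,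
`bᵢ = 1, cᵢ = 0` for the letter `ω₀ = 1/t` and `bᵢ = 0, cᵢ = 1` for `ω₁ = 1/(1-t)`, `a = 0`.
[folklore] -/
theorem isGenusZero_mzvRep (s : List ℕ) (hs : MZV.IsAdmissible s)
    (h₁ : IsSemialgebraicFunOn ℚ (KZ.openOrderedSimplex (MZV.weight s)) (KZ.mzvIntegrand s))
    (h₂ : IntegrableOn (KZ.mzvIntegrand s) (KZ.openOrderedSimplex (MZV.weight s)) volume) :
    IsGenusZero (KZ.mzvRep s hs h₁ h₂) := by
  refine ⟨1, fun _ _ => 0, fun i => if (MZV.binaryWord s).getD i false then 0 else 1,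
    fun i => if (MZV.binaryWord s).getD i false then 1 else 0, rfl, ?_⟩
  intro t _
  have key : ∀ i : Fin (MZV.weight s), KZ.mzvForm ((MZV.binaryWord s).getD i false) (t i) =
      (t i ^ (if (MZV.binaryWord s).getD i false then 0 else 1) *
        (1 - t i) ^ (if (MZV.binaryWord s).getD i false then 1 else 0))⁻¹ := by
    intro i
    unfold KZ.mzvForm
    split_ifs <;> simp
  show KZ.mzvIntegrand s t = gzIntegrand _ 1 _ _ _ t
  simp only [KZ.mzvIntegrand, gzIntegrand, key, map_one, pow_zero, ite_self,
    Finset.prod_const_one, mul_one, Finset.prod_inv_distrib, Finset.prod_mul_distrib, one_div]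

/-- The class of `mzvRep s` lies in the genus-zero generator set `Negative.gzSet` of the crux.
[folklore] -/
theorem of_mzvRep_mem_gzSet (s : List ℕ) (hs : MZV.IsAdmissible s)
    (h₁ : IsSemialgebraicFunOn ℚ (KZ.openOrderedSimplex (MZV.weight s)) (KZ.mzvIntegrand s))
    (h₂ : IntegrableOn (KZ.mzvIntegrand s) (KZ.openOrderedSimplex (MZV.weight s)) volume) :
    KZ.of (KZ.mzvRep s hs h₁ h₂) ∈ Negative.gzSet :=
  ⟨_, _, isGenusZero_mzvRep s hs h₁ h₂, rfl⟩

/-- **MZV word representations are genus-zero.** Every generator `[Δ_w, q·∏ᵢ ω_{εᵢ}(tᵢ)]`,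
`q ∈ ℚ`, of the target subgroup of `DihedralNormalForm` (`wordRepSet`) lies in `Negative.gzSet`
(`P = C q`, exponents read off the word, `a = 0`). [folklore] -/
theorem wordRepSet_subset_gzSet : wordRepSet ⊆ Negative.gzSet := by
  rintro x ⟨w, ε, q, s, hdom, hint, rfl⟩
  refine ⟨w, s, ⟨MvPolynomial.C q, fun _ _ => 0, fun i => if ε i then 0 else 1,
    fun i => if ε i then 1 else 0, hdom, ?_⟩, rfl⟩
  intro t ht
  rw [hint ht]
  have key : ∀ i : Fin w, (if ε i then 1 / (1 - t i) else 1 / t i) =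
      (t i ^ (if ε i then 0 else 1) * (1 - t i) ^ (if ε i then 1 else 0))⁻¹ := by
    intro i
    split_ifs <;> simp
  show (q : ℝ) * ∏ i, (if ε i then 1 / (1 - t i) else 1 / t i) = _
  rw [Finset.prod_congr rfl fun i _ => key i, Finset.prod_inv_distrib, Finset.prod_mul_distrib]
  simp only [gzIntegrand, MvPolynomial.aeval_C, eq_ratCast, pow_zero, ite_self,
    Finset.prod_const_one, mul_one, div_eq_mul_inv]

/-- Hence the subgroup generated by the MZV word representations is contained in the subgroup
generated by the genus-zero representations. [folklore] -/
theorem closure_wordRepSet_le_closure_gzSet :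
    AddSubgroup.closure wordRepSet ≤ AddSubgroup.closure Negative.gzSet :=
  AddSubgroup.closure_mono wordRepSet_subset_gzSet

/-! ## Monotonicity and the cross-route comparisons -/

/-- **Monotonicity of residuals.** If every vanishing combination is congruent modulo
`KZ.relations` to an element of `closure S` for some family `S` of genus-zero classes (more
generally `S ⊆ closure gzSet`), then `ResidualBeyondGenusZero` holds. [folklore] -/
theorem residualBeyondGenusZero_of_residualOnto {S : Set KZ.FormalRep}
    (hS : S ⊆ AddSubgroup.closure Negative.gzSet)
    (h : ∀ c : KZ.FormalRep, KZ.eval c = 0 → ∃ m ∈ AddSubgroup.closure S, c - m ∈ KZ.relations) :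
    ResidualBeyondGenusZero := by
  rw [Negative.residual_iff]
  intro c hc
  obtain ⟨m, hm, hcm⟩ := h c hc
  exact ⟨m, (AddSubgroup.closure_le _).2 hS hm, hcm⟩

/-- **ScissorsAvatars' declared complement implies RES.** `OffSectorReduction`
(stmt-KontsevichZagierPeriods-4265, route ScissorsAvatars: every vanishing combination is congruent
modulo `KZ.relations` to a vanishing `ℤ`-combination of canonical simplex representations `mzvRep s`
of ONE weight `w`) implies `ResidualBeyondGenusZero`: forget the weight and the vanishing, and use
`of_mzvRep_mem_gzSet`. RES is thus the weaker (more permissive) of the two declared residuals: mixed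
weights, rational coefficients inside the integrand and arbitrary genus-zero shapes are allowed.
[folklore] -/
theorem residualBeyondGenusZero_of_offSectorReduction (h : OffSectorReduction) :
    ResidualBeyondGenusZero := by
  rw [Negative.residual_iff]
  intro c hc
  obtain ⟨w, c', hc', -, hcc'⟩ := h c hc
  refine ⟨c', AddSubgroup.closure_mono ?_ hc', hcc'⟩
  rintro x ⟨s, hs, -, rfl⟩
  exact of_mzvRep_mem_gzSet s hs _ _

/-- **Kernel conjecture ⇒ ScissorsAvatars' declared complement** (take `w := 0`, `c' := 0`).
Together with `residualBeyondGenusZero_of_offSectorReduction` and the Strength file: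
`KZKernelConjecture ⇒ OffSectorReduction ⇒ ResidualBeyondGenusZero`, and back to
`KZKernelConjecture` granted the genus-zero sector cruxes. [folklore] -/
theorem offSectorReduction_of_kzKernelConjecture (hK : KZKernelConjecture) : OffSectorReduction :=
  fun c hc => ⟨0, 0, zero_mem _, map_zero _, by simpa using hK c hc⟩

/-- **The two declared residuals are equivalent granted the LinRedNormalForm sector.** Given the
genus-zero normal form `DihedralNormalForm` and the MZV kernel `MzvKernelInKZ`, both
`OffSectorReduction` (route ScissorsAvatars) and `ResidualBeyondGenusZero` are equivalent to the
kernel conjecture (`residualBeyondGenusZero_iff_kzKernelConjecture`, Strength file), hence to each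
other. [folklore] -/
theorem offSectorReduction_iff_residualBeyondGenusZero (hNF : DihedralNormalForm)
    (hKER : MzvKernelInKZ) : OffSectorReduction ↔ ResidualBeyondGenusZero :=
  ⟨residualBeyondGenusZero_of_offSectorReduction, fun h =>
    offSectorReduction_of_kzKernelConjecture
      ((residualBeyondGenusZero_iff_kzKernelConjecture hNF hKER).1 h)⟩

/-- **FurushoPentagon's kernel item implies RES.** Route FurushoPentagon's `SectorToKernel`
concludes the kernel conjecture verbatim from its two move-level hypotheses `StuffleInKZ` and
`HoffmanRelationInKZ`; composed with `residualBeyondGenusZero_of_kzKernelConjecture` (Strength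
file) it gives `ResidualBeyondGenusZero`. [folklore] -/
theorem residualBeyondGenusZero_of_sectorToKernel (h : SectorToKernel) (hSt : StuffleInKZ)
    (hHo : HoffmanRelationInKZ) : ResidualBeyondGenusZero :=
  residualBeyondGenusZero_of_kzKernelConjecture (h hSt hHo)

/-! ## After the normal form: the residual onto MZV word representations -/

/-- **RES ⇒ residual onto MZV words, granted the normal form.** If `DihedralNormalForm` holds
(every genus-zero representation is congruent modulo `KZ.relations` to a `ℤ`-combination of MZV
word representations), then `ResidualBeyondGenusZero` upgrades to: every vanishing combination is
congruent modulo `KZ.relations` to an element of `closure wordRepSet`. Proof in the lattice of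
subgroups: `ker eval ≤ relations ⊔ closure gzSet` (the residual) and
`closure gzSet ≤ relations ⊔ closure wordRepSet` (the normal form on generators, `closure_le`)
give `ker eval ≤ relations ⊔ closure wordRepSet`. [folklore] -/
theorem residualOntoWords_of_residualBeyondGenusZero (hNF : DihedralNormalForm)
    (h : ResidualBeyondGenusZero) :
    ∀ c : KZ.FormalRep, KZ.eval c = 0 →
      ∃ m ∈ AddSubgroup.closure wordRepSet, c - m ∈ KZ.relations := by
  have hGZ : AddSubgroup.closure Negative.gzSet ≤
      KZ.relations ⊔ AddSubgroup.closure wordRepSet := by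
    refine (AddSubgroup.closure_le _).2 ?_
    rintro x ⟨k, r, hr, rfl⟩
    obtain ⟨m, hm, hrm⟩ := (crux_iff.1 hNF) k r hr
    exact AddSubgroup.mem_sup.2 ⟨KZ.of r - m, hrm, m, hm, sub_add_cancel _ m⟩
  rw [Negative.residual_iff] at h
  intro c hc
  obtain ⟨c₀, hc₀, hcc₀⟩ := h c hc
  obtain ⟨y, hy, m, hm, hym⟩ := AddSubgroup.mem_sup.1 (hGZ hc₀)
  refine ⟨m, hm, ?_⟩
  have : c - m = (c - c₀) + y := by rw [← hym]; abel
  rw [this]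
  exact add_mem hcc₀ hy

/-- **Granted the normal form, RES is exactly the residual onto MZV word representations.**
(⇐) is monotonicity (`wordRepSet ⊆ gzSet`), with no hypothesis; (⇒) is
`residualOntoWords_of_residualBeyondGenusZero`. So once the crux `DihedralNormalForm` closes, the
route's declared residual reads "every vanishing formal combination is an MZV-word combination
modulo the moves" — the form in which the MZV kernel (`MzvKernelInKZ`, scoped as `HoffmanSpanInKZ` ∧
`HoffmanIndependence`) finishes the Assembly. [folklore] -/
theorem residualBeyondGenusZero_iff_residualOntoWords (hNF : DihedralNormalForm) :
    ResidualBeyondGenusZero ↔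
      ∀ c : KZ.FormalRep, KZ.eval c = 0 →
        ∃ m ∈ AddSubgroup.closure wordRepSet, c - m ∈ KZ.relations :=
  ⟨residualOntoWords_of_residualBeyondGenusZero hNF,
    residualBeyondGenusZero_of_residualOnto
      (wordRepSet_subset_gzSet.trans AddSubgroup.subset_closure)⟩

end Summit.KontsevichZagierPeriods.ResidualBeyondGenusZero
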